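import Summits.HodgeConjecture.HodgeConjecture.Theorems.HodgeLocusCensusSigmaFamily

/-!
# Hodge-locus census, cells (6, d, 2) and (8, d, 3) — THEOREM SM-∞ kernel-checked in full for k′ = 3, 4:
# the explicit Σ°-members `N·F₀ + F₁` are non-singular for every degree `d ≥ 4` and every `N ≥ 2d − 1`

certified instances and evidence bearing on the general Hodge conjecture; no claim.

ENGINE B gen 35 (record `ENGINEB-g35.md` §1).  Coordinates `a, b, x₀..x_{k−1}, y₀..y_{k−1}` on `ℙ^{2k+1}`, planes
`P₁ = V(a, y)`, `P₂ = V(b, y)`, degree `d = e + 3 ≥ 4`.  The Σ°-member of THEOREM SM-∞ is `F_N = N·F₀ + F₁` with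
`F₀ = Σ_j (y_j x_j^{e+2} + y_j^{e+3}) + a^{e+2} b + a b^{e+2}` and the Σ-coupling `F₁ = Σ_j y_j t_j + a b·x₀^{e} x₁`,
`t_j = −x_{j+1}^{e+1} x_{j+2}` (`j ≤ k−3`), `t_{k−2} = −x₀ x_{k−1}^{e+1}`, `t_{k−1} = 0`; i.e.
`k = 3`: `F₁ = −y₀ x₁^{e+1} x₂ − y₁ x₀ x₂^{e+1} + a b x₀^{e} x₁`;  `k = 4`: `F₁ = −y₀ x₁^{e+1} x₂ − y₁ x₂^{e+1} x₃ − y₂ x₀ x₃^{e+1}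
+ a b x₀^{e} x₁` (for `e = 1`, `N = 1` the latter is the member SM-2 of gen 34).  The hypotheses of the two MAIN THEOREMS
`sigma_member_k3_nonsingular` / `sigma_member_k4_nonsingular` list the 8 / 10 partial derivatives of `F_N`, each written as
`N·(∂F₀) + (∂F₁)` with `∂_{x_j}F₀ = (e+2) x_j^{e+1} y_j`, `∂_{y_j}F₀ = x_j^{e+2} + (e+3) y_j^{e+2}`, `∂_a F₀ = b((e+2)a^{e+1} + b^{e+1})`,
`∂_b F₀ = a(a^{e+1} + (e+2)b^{e+1})` and the partials of `F₁` expanded monomial by monomial; the conclusion is that they do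
not all vanish at any non-zero point, for every `e ≥ 1` and every real `N ≥ 2e + 5 = 2d − 1`: the hypersurfaces `V(F_N)`
in `ℙ⁷` / `ℙ⁹` are SMOOTH for the whole infinite family `(d, N)`.  The proof is the PERTURBATION LEMMA of the record: the
block gradient bounds `block_xy`, `block_ab` of the anchor `HodgeLocusCensusSigmaFamily` (imported), rescaled to sup-norm
`m` (`block_xy_scaled`, `block_ab_scaled`), against the coupling bounds `‖∂F₁‖ ≤ (e+2)·m^{e+2}` and `N > 2(e+2)` (`pert`).
The transcription of the partials was checked against implementation B's polynomial gradient in exact arithmetic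
(`gen35/check_k3_partials.py`, k = 3 and 4: 480 random Gaussian-integer points, 0 mismatches).  Def-free; imports only the
cell's accepted anchor `HodgeLocusCensusSigmaFamily` (Mathlib).
-/

namespace Summit.HodgeConjecture.HodgeConjecture.HodgeLocus.Census.SigmaFamilySmooth

open Summit.HodgeConjecture.HodgeConjecture.HodgeLocus.Census.SigmaFamily

/-- Rescaling to the unit polydisc: `‖x‖ ≤ m`, `m > 0` ⇒ `‖x/m‖ ≤ 1`. -/
theorem norm_div_real_le_one (x : ℂ) (m : ℝ) (hm : 0 < m) (hx : ‖x‖ ≤ m) : ‖x / (m : ℂ)‖ ≤ 1 := by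
  rw [norm_div, Complex.norm_real, Real.norm_of_nonneg hm.le]
  exact (div_le_one hm).mpr hx

/-- Rescaling to the unit polydisc: `‖x‖ = m`, `m > 0` ⇒ `‖x/m‖ = 1`. -/
theorem norm_div_real_eq_one (x : ℂ) (m : ℝ) (hm : 0 < m) (hx : ‖x‖ = m) : ‖x / (m : ℂ)‖ = 1 := by
  rw [norm_div, Complex.norm_real, Real.norm_of_nonneg hm.le, hx, div_self hm.ne']

/-- Block `y x^{e+2} + y^{e+3}` at sup-norm `m`: one of its two partials has norm `≥ m^{e+2}/2`. -/
theorem block_xy_scaled (e : ℕ) (he : 1 ≤ e) (x y : ℂ) (m : ℝ) (hm : 0 < m) (hx : ‖x‖ ≤ m) (hy : ‖y‖ ≤ m)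
    (h1 : ‖x‖ = m ∨ ‖y‖ = m) :
    (1 / 2) * m ^ (e + 2) ≤ ‖((e : ℂ) + 2) * x ^ (e + 1) * y‖ ∨
    (1 / 2) * m ^ (e + 2) ≤ ‖x ^ (e + 2) + ((e : ℂ) + 3) * y ^ (e + 2)‖ := by
  have hm0 : (m : ℂ) ≠ 0 := by exact_mod_cast hm.ne'
  have h1n : ‖x / (m : ℂ)‖ = 1 ∨ ‖y / (m : ℂ)‖ = 1 := by
    rcases h1 with h | h
    · exact Or.inl (norm_div_real_eq_one x m hm h)
    · exact Or.inr (norm_div_real_eq_one y m hm h)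
  have hb := block_xy (e + 3) (by omega) (x / m) (y / m)
    (norm_div_real_le_one x m hm hx) (norm_div_real_le_one y m hm hy) h1n
  rw [show e + 3 - 2 = e + 1 by omega, show e + 3 - 1 = e + 2 by omega] at hb
  have hc1 : (((e + 3 : ℕ) : ℂ)) - 1 = (e : ℂ) + 2 := by push_cast; ring
  have hc2 : (((e + 3 : ℕ) : ℂ)) = (e : ℂ) + 3 := by push_cast; ring
  rw [hc1, hc2] at hb
  have e1 : ((e : ℂ) + 2) * (x / m) ^ (e + 1) * (y / m)
      = (((e : ℂ) + 2) * x ^ (e + 1) * y) / (m : ℂ) ^ (e + 2) := by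
    rw [div_pow, mul_div_assoc' ((e : ℂ) + 2) (x ^ (e + 1)) ((m : ℂ) ^ (e + 1)), div_mul_div_comm, ← pow_succ]
  have e2 : (x / m) ^ (e + 2) + ((e : ℂ) + 3) * (y / m) ^ (e + 2)
      = (x ^ (e + 2) + ((e : ℂ) + 3) * y ^ (e + 2)) / (m : ℂ) ^ (e + 2) := by
    rw [div_pow, div_pow, mul_div_assoc' ((e : ℂ) + 3) (y ^ (e + 2)) ((m : ℂ) ^ (e + 2)), ← add_div]
  rw [e1, e2, norm_div, norm_div, norm_pow, Complex.norm_real, Real.norm_of_nonneg hm.le] at hb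
  have hmp : (0 : ℝ) < m ^ (e + 2) := pow_pos hm _
  rcases le_max_iff.mp hb with h | h
  · left; rw [le_div_iff₀ hmp] at h; linarith
  · right; rw [le_div_iff₀ hmp] at h; linarith

/-- Block `a^{e+2} b + a b^{e+2}` at sup-norm `m`: one of its two partials has norm `≥ m^{e+2}/2`. -/
theorem block_ab_scaled (e : ℕ) (he : 1 ≤ e) (a b : ℂ) (m : ℝ) (hm : 0 < m) (ha : ‖a‖ ≤ m) (hb' : ‖b‖ ≤ m)
    (h1 : ‖a‖ = m ∨ ‖b‖ = m) :
    (1 / 2) * m ^ (e + 2) ≤ ‖b * (((e : ℂ) + 2) * a ^ (e + 1) + b ^ (e + 1))‖ ∨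
    (1 / 2) * m ^ (e + 2) ≤ ‖a * (a ^ (e + 1) + ((e : ℂ) + 2) * b ^ (e + 1))‖ := by
  have hm0 : (m : ℂ) ≠ 0 := by exact_mod_cast hm.ne'
  have h1n : ‖a / (m : ℂ)‖ = 1 ∨ ‖b / (m : ℂ)‖ = 1 := by
    rcases h1 with h | h
    · exact Or.inl (norm_div_real_eq_one a m hm h)
    · exact Or.inr (norm_div_real_eq_one b m hm h)
  have hb := block_ab (e + 3) (by omega) (a / m) (b / m)
    (norm_div_real_le_one a m hm ha) (norm_div_real_le_one b m hm hb') h1n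
  rw [show e + 3 - 2 = e + 1 by omega] at hb
  have hc1 : (((e + 3 : ℕ) : ℂ)) - 1 = (e : ℂ) + 2 := by push_cast; ring
  rw [hc1] at hb
  have e1 : (b / m) * (((e : ℂ) + 2) * (a / m) ^ (e + 1) + (b / m) ^ (e + 1))
      = (b * (((e : ℂ) + 2) * a ^ (e + 1) + b ^ (e + 1))) / (m : ℂ) ^ (e + 2) := by
    rw [div_pow, div_pow, mul_div_assoc' ((e : ℂ) + 2) (a ^ (e + 1)) ((m : ℂ) ^ (e + 1)), ← add_div,
      div_mul_div_comm, ← pow_succ']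
  have e2 : (a / m) * ((a / m) ^ (e + 1) + ((e : ℂ) + 2) * (b / m) ^ (e + 1))
      = (a * (a ^ (e + 1) + ((e : ℂ) + 2) * b ^ (e + 1))) / (m : ℂ) ^ (e + 2) := by
    rw [div_pow, div_pow, mul_div_assoc' ((e : ℂ) + 2) (b ^ (e + 1)) ((m : ℂ) ^ (e + 1)), ← add_div,
      div_mul_div_comm, ← pow_succ']
  rw [e1, e2, norm_div, norm_div, norm_pow, Complex.norm_real, Real.norm_of_nonneg hm.le] at hb
  have hmp : (0 : ℝ) < m ^ (e + 2) := pow_pos hm _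
  rcases le_max_iff.mp hb with h | h
  · left; rw [le_div_iff₀ hmp] at h; linarith
  · right; rw [le_div_iff₀ hmp] at h; linarith

/-- If `‖p₀‖ ≥ c/2`, `‖p₁‖ ≤ M c`, `c > 0`, `0 ≤ M`, `N > 2M`, then `N p₀ + p₁ ≠ 0`. -/
theorem pert (N M c : ℝ) (p₀ p₁ : ℂ) (hc : 0 < c) (hM : 0 ≤ M) (hN : 2 * M < N)
    (h₀ : (1 / 2) * c ≤ ‖p₀‖) (h₁ : ‖p₁‖ ≤ M * c) (h : (N : ℂ) * p₀ + p₁ = 0) : False := by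
  have hNpos : 0 < N := by linarith
  have heq : (N : ℂ) * p₀ = -p₁ := eq_neg_of_add_eq_zero_left h
  have hn : ‖(N : ℂ) * p₀‖ = ‖p₁‖ := by rw [heq, norm_neg]
  rw [norm_mul, Complex.norm_real, Real.norm_of_nonneg hNpos.le] at hn
  have h2 : N * ((1 / 2) * c) ≤ N * ‖p₀‖ := mul_le_mul_of_nonneg_left h₀ hNpos.le
  nlinarith [mul_pos (by linarith : (0 : ℝ) < N - 2 * M) hc]

/-- THEOREM SM-∞, cell family `(6, e+3, 2)`: for `e ≥ 1`, real `N ≥ 2e + 5` and `(a,b,x₀,x₁,x₂,y₀,y₁,y₂) ≠ 0` the eight partial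
derivatives of `F_N = N·F₀ + F₁` (the eight hypotheses' left-hand sides) do not vanish simultaneously: `V(F_N) ⊂ ℙ⁷` is smooth. -/
theorem sigma_member_k3_nonsingular (e : ℕ) (he : 1 ≤ e) (N : ℝ) (hN : 2 * (e : ℝ) + 5 ≤ N)
    (a b x0 x1 x2 y0 y1 y2 : ℂ)
    (hne : ¬ (a = 0 ∧ b = 0 ∧ x0 = 0 ∧ x1 = 0 ∧ x2 = 0 ∧ y0 = 0 ∧ y1 = 0 ∧ y2 = 0)) :
    ¬ ( (N : ℂ) * (b * (((e : ℂ) + 2) * a ^ (e + 1) + b ^ (e + 1))) + b * x0 ^ e * x1 = 0 ∧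
        (N : ℂ) * (a * (a ^ (e + 1) + ((e : ℂ) + 2) * b ^ (e + 1))) + a * x0 ^ e * x1 = 0 ∧
        (N : ℂ) * (((e : ℂ) + 2) * x0 ^ (e + 1) * y0) + (-(y1 * x2 ^ (e + 1)) + (e : ℂ) * a * b * x0 ^ (e - 1) * x1) = 0 ∧
        (N : ℂ) * (((e : ℂ) + 2) * x1 ^ (e + 1) * y1) + (-(((e : ℂ) + 1) * y0 * x1 ^ e * x2) + a * b * x0 ^ e) = 0 ∧
        (N : ℂ) * (((e : ℂ) + 2) * x2 ^ (e + 1) * y2) + (-(y0 * x1 ^ (e + 1)) - ((e : ℂ) + 1) * y1 * x0 * x2 ^ e) = 0 ∧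
        (N : ℂ) * (x0 ^ (e + 2) + ((e : ℂ) + 3) * y0 ^ (e + 2)) + (-(x1 ^ (e + 1) * x2)) = 0 ∧
        (N : ℂ) * (x1 ^ (e + 2) + ((e : ℂ) + 3) * y1 ^ (e + 2)) + (-(x0 * x2 ^ (e + 1))) = 0 ∧
        (N : ℂ) * (x2 ^ (e + 2) + ((e : ℂ) + 3) * y2 ^ (e + 2)) + 0 = 0 ) := by
  rintro ⟨Ha, Hb, Hx0, Hx1, Hx2, Hy0, Hy1, Hy2⟩
  -- the sup norm m and the coordinate attaining it
  let v : Fin 8 → ℝ := ![‖a‖, ‖b‖, ‖x0‖, ‖x1‖, ‖x2‖, ‖y0‖, ‖y1‖, ‖y2‖]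
  obtain ⟨i, -, hi⟩ := Finset.exists_max_image Finset.univ v Finset.univ_nonempty
  have hA : ‖a‖ ≤ v i := by simpa [v] using hi 0 (Finset.mem_univ _)
  have hB : ‖b‖ ≤ v i := by simpa [v] using hi 1 (Finset.mem_univ _)
  have hX0 : ‖x0‖ ≤ v i := by simpa [v] using hi 2 (Finset.mem_univ _)
  have hX1 : ‖x1‖ ≤ v i := by simpa [v] using hi 3 (Finset.mem_univ _)
  have hX2 : ‖x2‖ ≤ v i := by simpa [v] using hi 4 (Finset.mem_univ _)
  have hY0 : ‖y0‖ ≤ v i := by simpa [v] using hi 5 (Finset.mem_univ _)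
  have hY1 : ‖y1‖ ≤ v i := by simpa [v] using hi 6 (Finset.mem_univ _)
  have hY2 : ‖y2‖ ≤ v i := by simpa [v] using hi 7 (Finset.mem_univ _)
  have hwhich : ‖a‖ = v i ∨ ‖b‖ = v i ∨ ‖x0‖ = v i ∨ ‖x1‖ = v i ∨ ‖x2‖ = v i ∨ ‖y0‖ = v i ∨
      ‖y1‖ = v i ∨ ‖y2‖ = v i := by fin_cases i <;> simp [v]
  generalize v i = m at hA hB hX0 hX1 hX2 hY0 hY1 hY2 hwhich
  -- m > 0, else everything vanishes
  have hm : 0 < m := by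
    by_contra hle
    have hle' : m ≤ 0 := not_lt.mp hle
    exact hne ⟨norm_le_zero_iff.mp (hA.trans hle'), norm_le_zero_iff.mp (hB.trans hle'),
      norm_le_zero_iff.mp (hX0.trans hle'), norm_le_zero_iff.mp (hX1.trans hle'),
      norm_le_zero_iff.mp (hX2.trans hle'), norm_le_zero_iff.mp (hY0.trans hle'),
      norm_le_zero_iff.mp (hY1.trans hle'), norm_le_zero_iff.mp (hY2.trans hle')⟩
  -- numeric facts
  have heR : (0 : ℝ) ≤ (e : ℝ) := by positivity
  have hM : (0 : ℝ) ≤ (e : ℝ) + 2 := by linarith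
  have hN' : 2 * ((e : ℝ) + 2) < N := by linarith
  have hc : (0 : ℝ) < m ^ (e + 2) := pow_pos hm _
  have hpow3 : m ^ (e + 2) = m * m * m ^ (e - 1) * m := by rw [show e + 2 = (e - 1) + 3 by omega]; ring
  -- coupling bounds ‖∂F₁‖ ≤ (e+2) m^{e+2}
  have hne1 : ‖((e : ℂ) + 1)‖ = (e : ℝ) + 1 := by
    rw [show ((e : ℂ) + 1) = (((e + 1 : ℕ)) : ℂ) by push_cast; ring, Complex.norm_natCast, Nat.cast_add, Nat.cast_one]
  have ca : ‖b * x0 ^ e * x1‖ ≤ ((e : ℝ) + 2) * m ^ (e + 2) := by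
    calc ‖b * x0 ^ e * x1‖ = ‖b‖ * ‖x0‖ ^ e * ‖x1‖ := by rw [norm_mul, norm_mul, norm_pow]
      _ ≤ m * m ^ e * m := by gcongr
      _ = 1 * m ^ (e + 2) := by ring
      _ ≤ ((e : ℝ) + 2) * m ^ (e + 2) := by gcongr; linarith
  have cb : ‖a * x0 ^ e * x1‖ ≤ ((e : ℝ) + 2) * m ^ (e + 2) := by
    calc ‖a * x0 ^ e * x1‖ = ‖a‖ * ‖x0‖ ^ e * ‖x1‖ := by rw [norm_mul, norm_mul, norm_pow]
      _ ≤ m * m ^ e * m := by gcongr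
      _ = 1 * m ^ (e + 2) := by ring
      _ ≤ ((e : ℝ) + 2) * m ^ (e + 2) := by gcongr; linarith
  have cx0 : ‖-(y1 * x2 ^ (e + 1)) + (e : ℂ) * a * b * x0 ^ (e - 1) * x1‖ ≤ ((e : ℝ) + 2) * m ^ (e + 2) := by
    have t1 : ‖-(y1 * x2 ^ (e + 1))‖ ≤ m ^ (e + 2) := by
      calc ‖-(y1 * x2 ^ (e + 1))‖ = ‖y1‖ * ‖x2‖ ^ (e + 1) := by rw [norm_neg, norm_mul, norm_pow]
        _ ≤ m * m ^ (e + 1) := by gcongr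
        _ = m ^ (e + 2) := by ring
    have t2 : ‖(e : ℂ) * a * b * x0 ^ (e - 1) * x1‖ ≤ (e : ℝ) * m ^ (e + 2) := by
      calc ‖(e : ℂ) * a * b * x0 ^ (e - 1) * x1‖ = (e : ℝ) * ‖a‖ * ‖b‖ * ‖x0‖ ^ (e - 1) * ‖x1‖ := by
            rw [norm_mul, norm_mul, norm_mul, norm_mul, norm_pow, Complex.norm_natCast]
        _ ≤ (e : ℝ) * m * m * m ^ (e - 1) * m := by gcongr
        _ = (e : ℝ) * m ^ (e + 2) := by rw [hpow3]; ring
    calc _ ≤ ‖-(y1 * x2 ^ (e + 1))‖ + ‖(e : ℂ) * a * b * x0 ^ (e - 1) * x1‖ := norm_add_le _ _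
      _ ≤ m ^ (e + 2) + (e : ℝ) * m ^ (e + 2) := add_le_add t1 t2
      _ ≤ ((e : ℝ) + 2) * m ^ (e + 2) := by nlinarith
  have cx1 : ‖-(((e : ℂ) + 1) * y0 * x1 ^ e * x2) + a * b * x0 ^ e‖ ≤ ((e : ℝ) + 2) * m ^ (e + 2) := by
    have t1 : ‖-(((e : ℂ) + 1) * y0 * x1 ^ e * x2)‖ ≤ ((e : ℝ) + 1) * m ^ (e + 2) := by
      calc ‖-(((e : ℂ) + 1) * y0 * x1 ^ e * x2)‖ = ((e : ℝ) + 1) * ‖y0‖ * ‖x1‖ ^ e * ‖x2‖ := by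
            rw [norm_neg, norm_mul, norm_mul, norm_mul, norm_pow, hne1]
        _ ≤ ((e : ℝ) + 1) * m * m ^ e * m := by gcongr
        _ = ((e : ℝ) + 1) * m ^ (e + 2) := by ring
    have t2 : ‖a * b * x0 ^ e‖ ≤ m ^ (e + 2) := by
      calc ‖a * b * x0 ^ e‖ = ‖a‖ * ‖b‖ * ‖x0‖ ^ e := by rw [norm_mul, norm_mul, norm_pow]
        _ ≤ m * m * m ^ e := by gcongr
        _ = m ^ (e + 2) := by ring
    calc _ ≤ ‖-(((e : ℂ) + 1) * y0 * x1 ^ e * x2)‖ + ‖a * b * x0 ^ e‖ := norm_add_le _ _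
      _ ≤ ((e : ℝ) + 1) * m ^ (e + 2) + m ^ (e + 2) := add_le_add t1 t2
      _ = ((e : ℝ) + 2) * m ^ (e + 2) := by ring
  have cx2 : ‖-(y0 * x1 ^ (e + 1)) - ((e : ℂ) + 1) * y1 * x0 * x2 ^ e‖ ≤ ((e : ℝ) + 2) * m ^ (e + 2) := by
    have t1 : ‖-(y0 * x1 ^ (e + 1))‖ ≤ m ^ (e + 2) := by
      calc ‖-(y0 * x1 ^ (e + 1))‖ = ‖y0‖ * ‖x1‖ ^ (e + 1) := by rw [norm_neg, norm_mul, norm_pow]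
        _ ≤ m * m ^ (e + 1) := by gcongr
        _ = m ^ (e + 2) := by ring
    have t2 : ‖((e : ℂ) + 1) * y1 * x0 * x2 ^ e‖ ≤ ((e : ℝ) + 1) * m ^ (e + 2) := by
      calc ‖((e : ℂ) + 1) * y1 * x0 * x2 ^ e‖ = ((e : ℝ) + 1) * ‖y1‖ * ‖x0‖ * ‖x2‖ ^ e := by
            rw [norm_mul, norm_mul, norm_mul, norm_pow, hne1]
        _ ≤ ((e : ℝ) + 1) * m * m * m ^ e := by gcongr
        _ = ((e : ℝ) + 1) * m ^ (e + 2) := by ring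
    calc _ ≤ ‖-(y0 * x1 ^ (e + 1))‖ + ‖((e : ℂ) + 1) * y1 * x0 * x2 ^ e‖ := norm_sub_le _ _
      _ ≤ m ^ (e + 2) + ((e : ℝ) + 1) * m ^ (e + 2) := add_le_add t1 t2
      _ = ((e : ℝ) + 2) * m ^ (e + 2) := by ring
  have cy0 : ‖-(x1 ^ (e + 1) * x2)‖ ≤ ((e : ℝ) + 2) * m ^ (e + 2) := by
    calc ‖-(x1 ^ (e + 1) * x2)‖ = ‖x1‖ ^ (e + 1) * ‖x2‖ := by rw [norm_neg, norm_mul, norm_pow]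
      _ ≤ m ^ (e + 1) * m := by gcongr
      _ = 1 * m ^ (e + 2) := by ring
      _ ≤ ((e : ℝ) + 2) * m ^ (e + 2) := by gcongr; linarith
  have cy1 : ‖-(x0 * x2 ^ (e + 1))‖ ≤ ((e : ℝ) + 2) * m ^ (e + 2) := by
    calc ‖-(x0 * x2 ^ (e + 1))‖ = ‖x0‖ * ‖x2‖ ^ (e + 1) := by rw [norm_neg, norm_mul, norm_pow]
      _ ≤ m * m ^ (e + 1) := by gcongr
      _ = 1 * m ^ (e + 2) := by ring
      _ ≤ ((e : ℝ) + 2) * m ^ (e + 2) := by gcongr; linarith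
  have cy2 : ‖(0 : ℂ)‖ ≤ ((e : ℝ) + 2) * m ^ (e + 2) := by rw [norm_zero]; positivity
  -- which coordinate attains the sup norm
  rcases hwhich with h1 | h1 | h1 | h1 | h1 | h1 | h1 | h1
  · rcases block_ab_scaled e he a b m hm hA hB (Or.inl h1) with h | h
    · exact pert N _ _ _ _ hc hM hN' h ca Ha
    · exact pert N _ _ _ _ hc hM hN' h cb Hb
  · rcases block_ab_scaled e he a b m hm hA hB (Or.inr h1) with h | h
    · exact pert N _ _ _ _ hc hM hN' h ca Ha
    · exact pert N _ _ _ _ hc hM hN' h cb Hb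
  · rcases block_xy_scaled e he x0 y0 m hm hX0 hY0 (Or.inl h1) with h | h
    · exact pert N _ _ _ _ hc hM hN' h cx0 Hx0
    · exact pert N _ _ _ _ hc hM hN' h cy0 Hy0
  · rcases block_xy_scaled e he x1 y1 m hm hX1 hY1 (Or.inl h1) with h | h
    · exact pert N _ _ _ _ hc hM hN' h cx1 Hx1
    · exact pert N _ _ _ _ hc hM hN' h cy1 Hy1
  · rcases block_xy_scaled e he x2 y2 m hm hX2 hY2 (Or.inl h1) with h | h
    · exact pert N _ _ _ _ hc hM hN' h cx2 Hx2
    · exact pert N _ _ _ _ hc hM hN' h cy2 Hy2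
  · rcases block_xy_scaled e he x0 y0 m hm hX0 hY0 (Or.inr h1) with h | h
    · exact pert N _ _ _ _ hc hM hN' h cx0 Hx0
    · exact pert N _ _ _ _ hc hM hN' h cy0 Hy0
  · rcases block_xy_scaled e he x1 y1 m hm hX1 hY1 (Or.inr h1) with h | h
    · exact pert N _ _ _ _ hc hM hN' h cx1 Hx1
    · exact pert N _ _ _ _ hc hM hN' h cy1 Hy1
  · rcases block_xy_scaled e he x2 y2 m hm hX2 hY2 (Or.inr h1) with h | h
    · exact pert N _ _ _ _ hc hM hN' h cx2 Hx2
    · exact pert N _ _ _ _ hc hM hN' h cy2 Hy2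

/-- THEOREM SM-∞, cell family `(8, e+3, 3)`: for `e ≥ 1`, real `N ≥ 2e + 5` and `(a,b,x₀,…,x₃,y₀,…,y₃) ≠ 0` the ten partial
derivatives of `F_N = N·F₀ + F₁` (the ten hypotheses' left-hand sides) do not vanish simultaneously: `V(F_N) ⊂ ℙ⁹` is smooth. -/
theorem sigma_member_k4_nonsingular (e : ℕ) (he : 1 ≤ e) (N : ℝ) (hN : 2 * (e : ℝ) + 5 ≤ N)
    (a b x0 x1 x2 x3 y0 y1 y2 y3 : ℂ)
    (hne : ¬ (a = 0 ∧ b = 0 ∧ x0 = 0 ∧ x1 = 0 ∧ x2 = 0 ∧ x3 = 0 ∧ y0 = 0 ∧ y1 = 0 ∧ y2 = 0 ∧ y3 = 0)) :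
    ¬ ( (N : ℂ) * (b * (((e : ℂ) + 2) * a ^ (e + 1) + b ^ (e + 1))) + b * x0 ^ e * x1 = 0 ∧
        (N : ℂ) * (a * (a ^ (e + 1) + ((e : ℂ) + 2) * b ^ (e + 1))) + a * x0 ^ e * x1 = 0 ∧
        (N : ℂ) * (((e : ℂ) + 2) * x0 ^ (e + 1) * y0) + (-(y2 * x3 ^ (e + 1)) + (e : ℂ) * a * b * x0 ^ (e - 1) * x1) = 0 ∧
        (N : ℂ) * (((e : ℂ) + 2) * x1 ^ (e + 1) * y1) + (-(((e : ℂ) + 1) * y0 * x1 ^ e * x2) + a * b * x0 ^ e) = 0 ∧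
        (N : ℂ) * (((e : ℂ) + 2) * x2 ^ (e + 1) * y2) + (-(y0 * x1 ^ (e + 1)) - ((e : ℂ) + 1) * y1 * x2 ^ e * x3) = 0 ∧
        (N : ℂ) * (((e : ℂ) + 2) * x3 ^ (e + 1) * y3) + (-(y1 * x2 ^ (e + 1)) - ((e : ℂ) + 1) * y2 * x0 * x3 ^ e) = 0 ∧
        (N : ℂ) * (x0 ^ (e + 2) + ((e : ℂ) + 3) * y0 ^ (e + 2)) + (-(x1 ^ (e + 1) * x2)) = 0 ∧
        (N : ℂ) * (x1 ^ (e + 2) + ((e : ℂ) + 3) * y1 ^ (e + 2)) + (-(x2 ^ (e + 1) * x3)) = 0 ∧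
        (N : ℂ) * (x2 ^ (e + 2) + ((e : ℂ) + 3) * y2 ^ (e + 2)) + (-(x0 * x3 ^ (e + 1))) = 0 ∧
        (N : ℂ) * (x3 ^ (e + 2) + ((e : ℂ) + 3) * y3 ^ (e + 2)) + 0 = 0 ) := by
  rintro ⟨Ha, Hb, Hx0, Hx1, Hx2, Hx3, Hy0, Hy1, Hy2, Hy3⟩
  -- the sup norm m and the coordinate attaining it
  let v : Fin 10 → ℝ := ![‖a‖, ‖b‖, ‖x0‖, ‖x1‖, ‖x2‖, ‖x3‖, ‖y0‖, ‖y1‖, ‖y2‖, ‖y3‖]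
  obtain ⟨i, -, hi⟩ := Finset.exists_max_image Finset.univ v Finset.univ_nonempty
  have hA : ‖a‖ ≤ v i := by simpa [v] using hi 0 (Finset.mem_univ _)
  have hB : ‖b‖ ≤ v i := by simpa [v] using hi 1 (Finset.mem_univ _)
  have hX0 : ‖x0‖ ≤ v i := by simpa [v] using hi 2 (Finset.mem_univ _)
  have hX1 : ‖x1‖ ≤ v i := by simpa [v] using hi 3 (Finset.mem_univ _)
  have hX2 : ‖x2‖ ≤ v i := by simpa [v] using hi 4 (Finset.mem_univ _)
  have hX3 : ‖x3‖ ≤ v i := by simpa [v] using hi 5 (Finset.mem_univ _)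
  have hY0 : ‖y0‖ ≤ v i := by simpa [v] using hi 6 (Finset.mem_univ _)
  have hY1 : ‖y1‖ ≤ v i := by simpa [v] using hi 7 (Finset.mem_univ _)
  have hY2 : ‖y2‖ ≤ v i := by simpa [v] using hi 8 (Finset.mem_univ _)
  have hY3 : ‖y3‖ ≤ v i := by simpa [v] using hi 9 (Finset.mem_univ _)
  have hwhich : ‖a‖ = v i ∨ ‖b‖ = v i ∨ ‖x0‖ = v i ∨ ‖x1‖ = v i ∨ ‖x2‖ = v i ∨ ‖x3‖ = v i ∨ ‖y0‖ = v i ∨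
      ‖y1‖ = v i ∨ ‖y2‖ = v i ∨ ‖y3‖ = v i := by fin_cases i <;> simp [v]
  generalize v i = m at hA hB hX0 hX1 hX2 hX3 hY0 hY1 hY2 hY3 hwhich
  have hm : 0 < m := by
    by_contra hle
    have hle' : m ≤ 0 := not_lt.mp hle
    exact hne ⟨norm_le_zero_iff.mp (hA.trans hle'), norm_le_zero_iff.mp (hB.trans hle'),
      norm_le_zero_iff.mp (hX0.trans hle'), norm_le_zero_iff.mp (hX1.trans hle'),
      norm_le_zero_iff.mp (hX2.trans hle'), norm_le_zero_iff.mp (hX3.trans hle'),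
      norm_le_zero_iff.mp (hY0.trans hle'), norm_le_zero_iff.mp (hY1.trans hle'),
      norm_le_zero_iff.mp (hY2.trans hle'), norm_le_zero_iff.mp (hY3.trans hle')⟩
  -- numeric facts
  have heR : (0 : ℝ) ≤ (e : ℝ) := by positivity
  have hM : (0 : ℝ) ≤ (e : ℝ) + 2 := by linarith
  have hN' : 2 * ((e : ℝ) + 2) < N := by linarith
  have hc : (0 : ℝ) < m ^ (e + 2) := pow_pos hm _
  have hpow3 : m ^ (e + 2) = m * m * m ^ (e - 1) * m := by rw [show e + 2 = (e - 1) + 3 by omega]; ring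
  have hne1 : ‖((e : ℂ) + 1)‖ = (e : ℝ) + 1 := by
    rw [show ((e : ℂ) + 1) = (((e + 1 : ℕ)) : ℂ) by push_cast; ring, Complex.norm_natCast, Nat.cast_add, Nat.cast_one]
  -- coupling bounds ‖∂F₁‖ ≤ (e+2) m^{e+2}
  have ca : ‖b * x0 ^ e * x1‖ ≤ ((e : ℝ) + 2) * m ^ (e + 2) := by
    calc ‖b * x0 ^ e * x1‖ = ‖b‖ * ‖x0‖ ^ e * ‖x1‖ := by rw [norm_mul, norm_mul, norm_pow]
      _ ≤ m * m ^ e * m := by gcongr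
      _ = 1 * m ^ (e + 2) := by ring
      _ ≤ ((e : ℝ) + 2) * m ^ (e + 2) := by gcongr; linarith
  have cb : ‖a * x0 ^ e * x1‖ ≤ ((e : ℝ) + 2) * m ^ (e + 2) := by
    calc ‖a * x0 ^ e * x1‖ = ‖a‖ * ‖x0‖ ^ e * ‖x1‖ := by rw [norm_mul, norm_mul, norm_pow]
      _ ≤ m * m ^ e * m := by gcongr
      _ = 1 * m ^ (e + 2) := by ring
      _ ≤ ((e : ℝ) + 2) * m ^ (e + 2) := by gcongr; linarith
  have cx0 : ‖-(y2 * x3 ^ (e + 1)) + (e : ℂ) * a * b * x0 ^ (e - 1) * x1‖ ≤ ((e : ℝ) + 2) * m ^ (e + 2) := by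
    have t1 : ‖-(y2 * x3 ^ (e + 1))‖ ≤ m ^ (e + 2) := by
      calc ‖-(y2 * x3 ^ (e + 1))‖ = ‖y2‖ * ‖x3‖ ^ (e + 1) := by rw [norm_neg, norm_mul, norm_pow]
        _ ≤ m * m ^ (e + 1) := by gcongr
        _ = m ^ (e + 2) := by ring
    have t2 : ‖(e : ℂ) * a * b * x0 ^ (e - 1) * x1‖ ≤ (e : ℝ) * m ^ (e + 2) := by
      calc ‖(e : ℂ) * a * b * x0 ^ (e - 1) * x1‖ = (e : ℝ) * ‖a‖ * ‖b‖ * ‖x0‖ ^ (e - 1) * ‖x1‖ := by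
            rw [norm_mul, norm_mul, norm_mul, norm_mul, norm_pow, Complex.norm_natCast]
        _ ≤ (e : ℝ) * m * m * m ^ (e - 1) * m := by gcongr
        _ = (e : ℝ) * m ^ (e + 2) := by rw [hpow3]; ring
    calc _ ≤ ‖-(y2 * x3 ^ (e + 1))‖ + ‖(e : ℂ) * a * b * x0 ^ (e - 1) * x1‖ := norm_add_le _ _
      _ ≤ m ^ (e + 2) + (e : ℝ) * m ^ (e + 2) := add_le_add t1 t2
      _ ≤ ((e : ℝ) + 2) * m ^ (e + 2) := by nlinarith
  have cx1 : ‖-(((e : ℂ) + 1) * y0 * x1 ^ e * x2) + a * b * x0 ^ e‖ ≤ ((e : ℝ) + 2) * m ^ (e + 2) := by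
    have t1 : ‖-(((e : ℂ) + 1) * y0 * x1 ^ e * x2)‖ ≤ ((e : ℝ) + 1) * m ^ (e + 2) := by
      calc ‖-(((e : ℂ) + 1) * y0 * x1 ^ e * x2)‖ = ((e : ℝ) + 1) * ‖y0‖ * ‖x1‖ ^ e * ‖x2‖ := by
            rw [norm_neg, norm_mul, norm_mul, norm_mul, norm_pow, hne1]
        _ ≤ ((e : ℝ) + 1) * m * m ^ e * m := by gcongr
        _ = ((e : ℝ) + 1) * m ^ (e + 2) := by ring
    have t2 : ‖a * b * x0 ^ e‖ ≤ m ^ (e + 2) := by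
      calc ‖a * b * x0 ^ e‖ = ‖a‖ * ‖b‖ * ‖x0‖ ^ e := by rw [norm_mul, norm_mul, norm_pow]
        _ ≤ m * m * m ^ e := by gcongr
        _ = m ^ (e + 2) := by ring
    calc _ ≤ ‖-(((e : ℂ) + 1) * y0 * x1 ^ e * x2)‖ + ‖a * b * x0 ^ e‖ := norm_add_le _ _
      _ ≤ ((e : ℝ) + 1) * m ^ (e + 2) + m ^ (e + 2) := add_le_add t1 t2
      _ = ((e : ℝ) + 2) * m ^ (e + 2) := by ring
  have cx2 : ‖-(y0 * x1 ^ (e + 1)) - ((e : ℂ) + 1) * y1 * x2 ^ e * x3‖ ≤ ((e : ℝ) + 2) * m ^ (e + 2) := by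
    have t1 : ‖-(y0 * x1 ^ (e + 1))‖ ≤ m ^ (e + 2) := by
      calc ‖-(y0 * x1 ^ (e + 1))‖ = ‖y0‖ * ‖x1‖ ^ (e + 1) := by rw [norm_neg, norm_mul, norm_pow]
        _ ≤ m * m ^ (e + 1) := by gcongr
        _ = m ^ (e + 2) := by ring
    have t2 : ‖((e : ℂ) + 1) * y1 * x2 ^ e * x3‖ ≤ ((e : ℝ) + 1) * m ^ (e + 2) := by
      calc ‖((e : ℂ) + 1) * y1 * x2 ^ e * x3‖ = ((e : ℝ) + 1) * ‖y1‖ * ‖x2‖ ^ e * ‖x3‖ := by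
            rw [norm_mul, norm_mul, norm_mul, norm_pow, hne1]
        _ ≤ ((e : ℝ) + 1) * m * m ^ e * m := by gcongr
        _ = ((e : ℝ) + 1) * m ^ (e + 2) := by ring
    calc _ ≤ ‖-(y0 * x1 ^ (e + 1))‖ + ‖((e : ℂ) + 1) * y1 * x2 ^ e * x3‖ := norm_sub_le _ _
      _ ≤ m ^ (e + 2) + ((e : ℝ) + 1) * m ^ (e + 2) := add_le_add t1 t2
      _ = ((e : ℝ) + 2) * m ^ (e + 2) := by ring
  have cx3 : ‖-(y1 * x2 ^ (e + 1)) - ((e : ℂ) + 1) * y2 * x0 * x3 ^ e‖ ≤ ((e : ℝ) + 2) * m ^ (e + 2) := by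
    have t1 : ‖-(y1 * x2 ^ (e + 1))‖ ≤ m ^ (e + 2) := by
      calc ‖-(y1 * x2 ^ (e + 1))‖ = ‖y1‖ * ‖x2‖ ^ (e + 1) := by rw [norm_neg, norm_mul, norm_pow]
        _ ≤ m * m ^ (e + 1) := by gcongr
        _ = m ^ (e + 2) := by ring
    have t2 : ‖((e : ℂ) + 1) * y2 * x0 * x3 ^ e‖ ≤ ((e : ℝ) + 1) * m ^ (e + 2) := by
      calc ‖((e : ℂ) + 1) * y2 * x0 * x3 ^ e‖ = ((e : ℝ) + 1) * ‖y2‖ * ‖x0‖ * ‖x3‖ ^ e := by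
            rw [norm_mul, norm_mul, norm_mul, norm_pow, hne1]
        _ ≤ ((e : ℝ) + 1) * m * m * m ^ e := by gcongr
        _ = ((e : ℝ) + 1) * m ^ (e + 2) := by ring
    calc _ ≤ ‖-(y1 * x2 ^ (e + 1))‖ + ‖((e : ℂ) + 1) * y2 * x0 * x3 ^ e‖ := norm_sub_le _ _
      _ ≤ m ^ (e + 2) + ((e : ℝ) + 1) * m ^ (e + 2) := add_le_add t1 t2
      _ = ((e : ℝ) + 2) * m ^ (e + 2) := by ring
  have cy0 : ‖-(x1 ^ (e + 1) * x2)‖ ≤ ((e : ℝ) + 2) * m ^ (e + 2) := by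
    calc ‖-(x1 ^ (e + 1) * x2)‖ = ‖x1‖ ^ (e + 1) * ‖x2‖ := by rw [norm_neg, norm_mul, norm_pow]
      _ ≤ m ^ (e + 1) * m := by gcongr
      _ = 1 * m ^ (e + 2) := by ring
      _ ≤ ((e : ℝ) + 2) * m ^ (e + 2) := by gcongr; linarith
  have cy1 : ‖-(x2 ^ (e + 1) * x3)‖ ≤ ((e : ℝ) + 2) * m ^ (e + 2) := by
    calc ‖-(x2 ^ (e + 1) * x3)‖ = ‖x2‖ ^ (e + 1) * ‖x3‖ := by rw [norm_neg, norm_mul, norm_pow]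
      _ ≤ m ^ (e + 1) * m := by gcongr
      _ = 1 * m ^ (e + 2) := by ring
      _ ≤ ((e : ℝ) + 2) * m ^ (e + 2) := by gcongr; linarith
  have cy2 : ‖-(x0 * x3 ^ (e + 1))‖ ≤ ((e : ℝ) + 2) * m ^ (e + 2) := by
    calc ‖-(x0 * x3 ^ (e + 1))‖ = ‖x0‖ * ‖x3‖ ^ (e + 1) := by rw [norm_neg, norm_mul, norm_pow]
      _ ≤ m * m ^ (e + 1) := by gcongr
      _ = 1 * m ^ (e + 2) := by ring
      _ ≤ ((e : ℝ) + 2) * m ^ (e + 2) := by gcongr; linarith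
  have cy3 : ‖(0 : ℂ)‖ ≤ ((e : ℝ) + 2) * m ^ (e + 2) := by rw [norm_zero]; positivity
  -- which coordinate attains the sup norm
  rcases hwhich with h1 | h1 | h1 | h1 | h1 | h1 | h1 | h1 | h1 | h1
  · rcases block_ab_scaled e he a b m hm hA hB (Or.inl h1) with h | h
    · exact pert N _ _ _ _ hc hM hN' h ca Ha
    · exact pert N _ _ _ _ hc hM hN' h cb Hb
  · rcases block_ab_scaled e he a b m hm hA hB (Or.inr h1) with h | h
    · exact pert N _ _ _ _ hc hM hN' h ca Ha
    · exact pert N _ _ _ _ hc hM hN' h cb Hb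
  · rcases block_xy_scaled e he x0 y0 m hm hX0 hY0 (Or.inl h1) with h | h
    · exact pert N _ _ _ _ hc hM hN' h cx0 Hx0
    · exact pert N _ _ _ _ hc hM hN' h cy0 Hy0
  · rcases block_xy_scaled e he x1 y1 m hm hX1 hY1 (Or.inl h1) with h | h
    · exact pert N _ _ _ _ hc hM hN' h cx1 Hx1
    · exact pert N _ _ _ _ hc hM hN' h cy1 Hy1
  · rcases block_xy_scaled e he x2 y2 m hm hX2 hY2 (Or.inl h1) with h | h
    · exact pert N _ _ _ _ hc hM hN' h cx2 Hx2
    · exact pert N _ _ _ _ hc hM hN' h cy2 Hy2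
  · rcases block_xy_scaled e he x3 y3 m hm hX3 hY3 (Or.inl h1) with h | h
    · exact pert N _ _ _ _ hc hM hN' h cx3 Hx3
    · exact pert N _ _ _ _ hc hM hN' h cy3 Hy3
  · rcases block_xy_scaled e he x0 y0 m hm hX0 hY0 (Or.inr h1) with h | h
    · exact pert N _ _ _ _ hc hM hN' h cx0 Hx0
    · exact pert N _ _ _ _ hc hM hN' h cy0 Hy0
  · rcases block_xy_scaled e he x1 y1 m hm hX1 hY1 (Or.inr h1) with h | h
    · exact pert N _ _ _ _ hc hM hN' h cx1 Hx1
    · exact pert N _ _ _ _ hc hM hN' h cy1 Hy1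
  · rcases block_xy_scaled e he x2 y2 m hm hX2 hY2 (Or.inr h1) with h | h
    · exact pert N _ _ _ _ hc hM hN' h cx2 Hx2
    · exact pert N _ _ _ _ hc hM hN' h cy2 Hy2
  · rcases block_xy_scaled e he x3 y3 m hm hX3 hY3 (Or.inr h1) with h | h
    · exact pert N _ _ _ _ hc hM hN' h cx3 Hx3
    · exact pert N _ _ _ _ hc hM hN' h cy3 Hy3

end Summit.HodgeConjecture.HodgeConjecture.HodgeLocus.Census.SigmaFamilySmooth
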